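import Mathlib
import Summits.ValiantsHypothesis.ValiantsHypothesis.Theorems.LiouvilleSarnakAlignedTypeICharactersMod2nBilinearSieveTools
import HarnessLib

/-!
# Route LiouvilleSarnak — support `AlignedTypeI` (stmt-ValiantsHypothesis-21040), line `characters_mod_2n`:
# counting lemmas for the bilinear reduction (residue classes in intervals, the large sieve on an interval)

Companion to `…BilinearSieveTools.lean` (Plancherel / large sieve for one modulus) and input to `…BilinearSieve.lean`
(the bilinear inequality for `Σ_{ψ ≠ 1} |Σ_{m ≤ x} λ(m)ψ(m)|²`): `|λ|² ≤ 1`, a residue class mod `q` meets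
`(a, b]` in at most `(b − a)/q + 2` points, hence the large sieve for one modulus on an interval of integers
`Σ_ψ |Σ_{a<m≤b} c(m)ψ(m)|² ≤ (b − a + 2q) Σ |c(m)|²` (`largeSieve_Ioc`), and the mean square of the twisted Liouville sums
`Σ_ψ |Σ_{r ≤ y} λψ|² ≤ (y + 2q) y` (`sum_char_norm_sq_liouville_le`).

HONEST FRAMING. Bookkeeping only (all folklore, def-free); `AlignedTypeI` is NOT closed here; nothing bears on
`VP ≠ VNP` (NOT proved).
-/

set_option linter.dupNamespace false

noncomputable section

namespace Summit.ValiantsHypothesis.ValiantsHypothesis.Theorems.LiouvilleSarnak.AlignedTypeI.CharactersModTwoN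

open ArithmeticFunction Finset
open scoped BigOperators

/-! ## §0 Small facts -/

/-- `|λ(n)|² ≤ 1` in `ℂ` (the form the large sieve consumes). [folklore] -/
theorem norm_sq_liouville_intCast_le_one (n : ℕ) : ‖((liouville n : ℤ) : ℂ)‖ ^ 2 ≤ 1 := by
  by_cases hn : n = 0
  · subst hn
    simp
  · rw [liouville_apply hn]
    push_cast
    rw [norm_pow, norm_neg, norm_one, one_pow, one_pow]

/-- A residue class meets `(a, b]` in at most `(b − a)/q + 2` points. [folklore] -/
theorem card_Ioc_filter_natCast_eq_le {q : ℕ} [NeZero q] (a b : ℕ) (u : ZMod q) :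
    ((Finset.Ioc a b).filter (fun m : ℕ => (m : ZMod q) = u)).card ≤ (b - a) / q + 2 := by
  classical
  have hq : 0 < q := Nat.pos_of_ne_zero (NeZero.ne q)
  set S := (Finset.Ioc a b).filter (fun m : ℕ => (m : ZMod q) = u) with hS
  by_cases hab : a ≤ b
  · -- `m ↦ m / q` is injective on a residue class
    have hinj : Set.InjOn (fun m : ℕ => m / q) (S : Set ℕ) := by
      intro m hm m' hm' h
      simp only [Finset.coe_filter, Set.mem_setOf_eq, hS] at hm hm'
      have hmod : m % q = m' % q := by
        have h1 : (m : ZMod q) = (m' : ZMod q) := by rw [hm.2, hm'.2]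
        rw [ZMod.natCast_eq_natCast_iff'] at h1
        exact h1
      rw [← Nat.div_add_mod m q, ← Nat.div_add_mod m' q, hmod]
      simp only at h
      rw [h]
    have himage : S.image (fun m : ℕ => m / q) ⊆ Finset.Icc (a / q) (b / q) := by
      intro y hy
      rw [Finset.mem_image] at hy
      obtain ⟨m, hm, rfl⟩ := hy
      rw [hS, Finset.mem_filter, Finset.mem_Ioc] at hm
      rw [Finset.mem_Icc]
      exact ⟨Nat.div_le_div_right hm.1.1.le, Nat.div_le_div_right hm.1.2⟩
    have h2 : b / q ≤ (b - a) / q + a / q + 1 := by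
      have h3 := Nat.add_div (a := b - a) (b := a) hq
      rw [Nat.sub_add_cancel hab] at h3
      generalize (b - a) / q = f at h3 ⊢
      generalize a / q = g at h3 ⊢
      generalize b / q = h at h3 ⊢
      split_ifs at h3 <;> omega
    calc S.card = (S.image (fun m : ℕ => m / q)).card := (Finset.card_image_of_injOn hinj).symm
      _ ≤ (Finset.Icc (a / q) (b / q)).card := Finset.card_le_card himage
      _ = b / q + 1 - a / q := Nat.card_Icc _ _
      _ ≤ (b - a) / q + 2 := by
          generalize (b - a) / q = f at h2 ⊢
          generalize a / q = g at h2 ⊢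
          generalize b / q = h at h2 ⊢
          omega
  · have hempty : S = ∅ := by
      rw [hS, Finset.Ioc_eq_empty (fun h => hab h.le), Finset.filter_empty]
    rw [hempty, Finset.card_empty]
    exact Nat.zero_le _

/-- The large sieve for one modulus on an interval of integers: for `c : ℕ → ℂ`,
`Σ_ψ |Σ_{a < m ≤ b} c(m) ψ(m)|² ≤ (b − a + 2q) Σ_{a < m ≤ b} |c(m)|²`. [folklore] -/
theorem largeSieve_Ioc {q : ℕ} [NeZero q] (a b : ℕ) (hab : a ≤ b) (c : ℕ → ℂ) :
    ∑ ψ : DirichletCharacter ℂ q, ‖∑ m ∈ Finset.Ioc a b, c m * ψ (m : ZMod q)‖ ^ 2 ≤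
      (((b : ℝ) - a) + 2 * q) * ∑ m ∈ Finset.Ioc a b, ‖c m‖ ^ 2 := by
  have hq : 0 < q := Nat.pos_of_ne_zero (NeZero.ne q)
  have h := largeSieve_single (Finset.Ioc a b) (fun m : ℕ => (m : ZMod q)) c ((b - a) / q + 2)
    (fun u => card_Ioc_filter_natCast_eq_le (q := q) a b (u : ZMod q))
  refine h.trans ?_
  have hs : 0 ≤ ∑ m ∈ Finset.Ioc a b, ‖c m‖ ^ 2 := Finset.sum_nonneg fun m _ => by positivity
  gcongr
  -- `φ(q) ((b-a)/q + 2) ≤ (b - a) + 2q`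
  have hφ : (Nat.totient q : ℝ) ≤ q := by exact_mod_cast Nat.totient_le q
  have hdiv : (((b - a) / q : ℕ) : ℝ) ≤ ((b : ℝ) - a) / q := by
    have h1 : (((b - a) / q : ℕ) : ℝ) ≤ ((b - a : ℕ) : ℝ) / q := Nat.cast_div_le
    rw [Nat.cast_sub hab] at h1
    exact h1
  have hqR : (0 : ℝ) < q := by exact_mod_cast hq
  have hba : (0 : ℝ) ≤ (b : ℝ) - a := by
    have : (a : ℝ) ≤ b := by exact_mod_cast hab
    linarith
  push_cast
  calc (Nat.totient q : ℝ) * ((((b - a) / q : ℕ) : ℝ) + 2) ≤ q * (((b : ℝ) - a) / q + 2) := by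
        gcongr
    _ = ((b : ℝ) - a) + 2 * q := by field_simp

/-- Mean square of the twisted Liouville sums over all characters mod `q`, by the large sieve for one modulus:
`Σ_ψ |Σ_{r ≤ y} λ(r)ψ(r)|² ≤ (y + 2q) · y`. [folklore] -/
theorem sum_char_norm_sq_liouville_le {q : ℕ} [NeZero q] (y : ℕ) :
    ∑ ψ : DirichletCharacter ℂ q, ‖∑ r ∈ Finset.Ioc 0 y, (liouville r : ℂ) * ψ (r : ZMod q)‖ ^ 2 ≤
      ((y : ℝ) + 2 * q) * y := by
  have hls := largeSieve_Ioc (q := q) 0 y (Nat.zero_le y) (fun r => (liouville r : ℂ))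
  refine hls.trans ?_
  have hcoef : ∑ r ∈ Finset.Ioc 0 y, ‖(liouville r : ℂ)‖ ^ 2 ≤ y := by
    calc ∑ r ∈ Finset.Ioc 0 y, ‖(liouville r : ℂ)‖ ^ 2 ≤ ∑ r ∈ Finset.Ioc 0 y, (1 : ℝ) :=
          Finset.sum_le_sum fun r _ => norm_sq_liouville_intCast_le_one r
      _ = y := by simp
  have hy2q : 0 ≤ ((y : ℝ) - (0 : ℕ)) + 2 * q := by rw [Nat.cast_zero, sub_zero]; positivity
  calc (((y : ℝ) - (0 : ℕ)) + 2 * q) * ∑ r ∈ Finset.Ioc 0 y, ‖(liouville r : ℂ)‖ ^ 2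
      ≤ (((y : ℝ) - (0 : ℕ)) + 2 * q) * y := mul_le_mul_of_nonneg_left hcoef hy2q
    _ = ((y : ℝ) + 2 * q) * y := by push_cast; ring

end Summit.ValiantsHypothesis.ValiantsHypothesis.Theorems.LiouvilleSarnak.AlignedTypeI.CharactersModTwoN
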